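import Mathlib
import Literature.NumberTheory.Sieve.LiouvillePolynomialValues
import Literature.NumberTheory.Sieve.LiouvillePolynomialValuesProofs
import Literature.NumberTheory.Sieve.LiouvillePolynomialValuesDensity
import HarnessLib

/-!
# The Liouville function at polynomial arguments — proofs, III: the odd-multiplicity-roots form

Third sibling of `Literature/NumberTheory/Sieve/LiouvillePolynomialValues.lean` (J. Teräväinen,
Amer. J. Math. 146 (2024) 1115–1167 = arXiv:2010.07924, `Teravainen2024`), after
`LiouvillePolynomialValuesProofs.lean` (structure lemma) and `LiouvillePolynomialValuesDensity.lean`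
(reduction of Corollary 2.1 to Theorem 2.6 for `λ`; the case `deg P ≤ 2`).  Everything is PROVED;
no definition, no named fact (D-0026); supports the undischarged fact `teravainen2024_cor_2_1`.

The reduction only ever sees the distinct rational roots of `P` of ODD multiplicity (even
multiplicities and the constant contribute a fixed sign to `λ(P(n))`), so the natural truncation
parameter is their number, not `deg P`.  This file re-runs the packaging with that sharp count:

* `roots_eq_map_of_map_eq`, `oddRoots_eq_of_map_eq` — for `P = c ∏ᵢ (x − rᵢ)` over `ℚ`, the
  multiset `Polynomial.roots` is `(rᵢ)ᵢ`, and the finset of odd-multiplicity roots computed from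
  `roots`/`Multiset.count` is the one used in the structure lemma [folklore];
* `exists_linearForms_card_eq_oddRoots` — the structure lemma with
  `k = #{ρ root of P over ℚ : multiplicity of ρ odd}`;
* `lowerDensity_of_forms_of_correlationBound` — the body of the reduction, parametrised by the
  forms: identity `λ(P(n+N)) = ε ∏ λ(aᵢn+bᵢ)` + 99% bound with `δ` ⟹ each sign has lower density
  `≥ δ/4` on `[1, x]` for `x ≥ max(x₀ + N, 2N)`;
* `teravainen2024_cor_2_1_of_correlationBound_oddRoots` — Theorem 2.6 for `λ` and `k ≤ K` forms ⟹
  Corollary 2.1 for all non-square split `P` with `≤ K` odd-multiplicity roots;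
* `teravainen2024_cor_2_1_of_oddRoots_le_two` — **Corollary 2.1 for `P` with at most two rational
  roots of odd multiplicity, PROVED unconditionally** (Tao 2016 via
  `liouville_correlationBound_of_le_two`): e.g. `x³(x+1)⁵(x+2)²`; axioms `propext`,
  `Classical.choice`, `Quot.sound`.

Three or more odd-multiplicity roots is exactly where Theorem 2.6 with `k ≥ 3` (§5 of the paper;
not in the tree) is needed; see the module docstring of `LiouvillePolynomialValuesDensity.lean`.

## References
* J. Teräväinen, Amer. J. Math. 146 (2024) 1115–1167; arXiv:2010.07924: Corollary 2.1, Theorem 2.6.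
  [Teravainen2024]
* T. Tao, Forum Math. Pi 4 (2016), e8: Theorem 1.3. [TaoFMP2016]
-/

namespace Literature.NumberTheory.Sieve

open Polynomial Finset


section OddRoots

/-- The roots (with multiplicity) of a split polynomial `c ∏ᵢ (x − rᵢ)`, `c ≠ 0`, over `ℚ` are the
`rᵢ`. [folklore] -/
theorem roots_eq_map_of_map_eq {P : ℤ[X]} {m : ℕ} {c : ℚ} {r : Fin m → ℚ}
    (hP : P.map (Int.castRingHom ℚ) = C c * ∏ i, (X - C (r i))) (hc : c ≠ 0) :
    (P.map (Int.castRingHom ℚ)).roots = univ.val.map r := by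
  rw [hP, roots_C_mul _ hc, Finset.prod_eq_multiset_prod]
  have : (fun i => X - C (r i)) = (fun a : ℚ => X - C a) ∘ r := rfl
  rw [this, ← Multiset.map_map, roots_multiset_prod_X_sub_C]

/-- For a split polynomial `c ∏ᵢ (x − rᵢ)` (`c ≠ 0`), the set of distinct roots of odd multiplicity,
computed from `Polynomial.roots`, is the set of values `ρ` of `r` hit an odd number of times.
[folklore] -/
theorem oddRoots_eq_of_map_eq {P : ℤ[X]} {m : ℕ} {c : ℚ} {r : Fin m → ℚ}
    (hP : P.map (Int.castRingHom ℚ) = C c * ∏ i, (X - C (r i))) (hc : c ≠ 0) :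
    (P.map (Int.castRingHom ℚ)).roots.toFinset.filter
        (fun ρ => Odd ((P.map (Int.castRingHom ℚ)).roots.count ρ))
      = (univ.image r).filter (fun ρ => Odd ((univ.filter (fun i => r i = ρ)).card)) := by
  classical
  rw [roots_eq_map_of_map_eq hP hc, Multiset.toFinset_map, Finset.val_toFinset]
  refine filter_congr fun ρ _ => ?_
  rw [Multiset.count_map]
  have : (Multiset.filter (fun a => ρ = r a) univ.val).card = (univ.filter (fun i => r i = ρ)).card := by
    rw [Finset.card_def, Finset.filter_val]
    congr 1
    exact Multiset.filter_congr fun i _ => eq_comm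
  rw [this]

/-- **Structure lemma, sharp count.** As `exists_linearForms_of_isNonSquarePoly`, but with the number
of forms EQUAL to the number of distinct rational roots of `P` of odd multiplicity (computed from
`Polynomial.roots` of `P` over `ℚ`). [cite: Teravainen2024, §2.1 (before Corollary 2.1) and §2.2.1 (Remarks after Theorem 2.6)] -/
theorem exists_linearForms_card_eq_oddRoots {P : ℤ[X]} (hns : IsNonSquarePoly P)
    (hsp : FactorsIntoLinearFactorsOverRat P) :
    ∃ (k : ℕ) (a b : Fin k → ℕ) (ε : ℤ) (N : ℕ),
      1 ≤ k ∧
      k = ((P.map (Int.castRingHom ℚ)).roots.toFinset.filter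
            (fun ρ => Odd ((P.map (Int.castRingHom ℚ)).roots.count ρ))).card ∧
      (∀ i, 1 ≤ a i) ∧ (∀ i, 1 ≤ b i) ∧
      (∀ i j, i ≠ j → a i * b j ≠ a j * b i) ∧ (ε = 1 ∨ ε = -1) ∧
      ∀ n : ℕ, liouvilleInt (P.eval ((n : ℤ) + N))
        = ε * ∏ i, (ArithmeticFunction.liouville (a i * n + b i) : ℤ) := by
  classical
  obtain ⟨m, c, r, hP⟩ := hsp
  set S := (univ.image r).filter (fun ρ => Odd ((univ.filter (fun i => r i = ρ)).card)) with hS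
  set Nz : ℕ := 1 + ∑ ρ ∈ univ.image r, ρ.num.natAbs with hNz
  set D : ℤ := ∏ ρ ∈ univ.image r, (ρ.den : ℤ) ^ (univ.filter (fun i => r i = ρ)).card with hDdef
  have hcast : (1 : ℤ) + ∑ σ ∈ univ.image r, (σ.num.natAbs : ℤ) = (Nz : ℤ) := by
    rw [hNz]; push_cast; rfl
  have hP0 : P ≠ 0 := by
    intro h0
    have := hns.1
    rw [h0, leadingCoeff_zero] at this
    exact lt_irrefl _ this
  have hc : c ≠ 0 := by
    intro h0
    rw [h0, map_zero, zero_mul, Polynomial.map_eq_zero_iff (Int.castRingHom ℚ).injective_int] at hP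
    exact hP0 hP
  have hSne : S.Nonempty := by
    by_contra hempty
    rw [not_nonempty_iff_eq_empty, hS, filter_eq_empty_iff] at hempty
    obtain ⟨c', Q, hQ⟩ := exists_eq_C_mul_sq_of_forall_even hP
      (fun ρ hρ => Nat.not_odd_iff_even.1 (hempty hρ))
    exact hns.2 ⟨c', Q, hQ⟩
  set e := S.equivFin with he
  have hmemR : ∀ i : Fin S.card, (e.symm i).1 ∈ univ.image r := fun i =>
    (mem_filter.1 (e.symm i).2).1
  have hb1 : ∀ i : Fin S.card, 1 ≤ ((e.symm i).1.den : ℤ) * Nz - (e.symm i).1.num := fun i =>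
    one_le_den_mul_sub_num (hmemR i) hcast.le
  refine ⟨S.card, fun i => (e.symm i).1.den,
    fun i => (((e.symm i).1.den : ℤ) * Nz - (e.symm i).1.num).toNat,
    liouvilleInt c.den * liouvilleInt D * liouvilleInt c.num, Nz,
    hSne.card_pos, ?_, fun i => (e.symm i).1.den_pos, ?_, ?_, ?_, ?_⟩
  · rw [oddRoots_eq_of_map_eq hP hc]
  · intro i
    have := hb1 i
    show (1 : ℕ) ≤ (((e.symm i).1.den : ℤ) * Nz - (e.symm i).1.num).toNat
    omega
  · intro i j hij hEq
    have hρ : (e.symm i).1 ≠ (e.symm j).1 := fun h =>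
      hij (e.symm.injective (Subtype.ext h))
    have hi1 := hb1 i
    have hj1 := hb1 j
    have hEqZ := congrArg (fun t : ℕ => (t : ℤ)) hEq
    simp only [Nat.cast_mul] at hEqZ
    rw [Int.toNat_of_nonneg (by omega), Int.toNat_of_nonneg (by omega)] at hEqZ
    apply hρ
    rw [Rat.eq_iff_mul_eq_mul]
    linear_combination hEqZ
  · have hD : D ≠ 0 :=
      prod_ne_zero_iff.2 fun ρ _ => pow_ne_zero _ (by exact_mod_cast ρ.den_ne_zero)
    have hu : ∀ z : ℤ, z ≠ 0 → IsUnit (liouvilleInt z) := fun z hz => by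
      rcases liouvilleInt_eq_one_or_eq_neg_one hz with h | h <;> simp [h]
    have hden : (c.den : ℤ) ≠ 0 := by exact_mod_cast c.den_ne_zero
    exact Int.isUnit_iff.1 (((hu _ hden).mul (hu D hD)).mul (hu _ (Rat.num_ne_zero.2 hc)))
  · intro n
    have hnN : (1 : ℤ) + ∑ σ ∈ univ.image r, (σ.num.natAbs : ℤ) ≤ (n : ℤ) + Nz := by
      rw [hcast]; omega
    have hne : ∀ ρ ∈ univ.image r, (ρ.den : ℤ) * ((n : ℤ) + Nz) - ρ.num ≠ 0 := fun ρ hρ => by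
      have := one_le_den_mul_sub_num hρ hnN
      omega
    rw [liouvilleInt_eval_eq_sign_mul_prod hP ((n : ℤ) + Nz) hne]
    congr 1
    rw [← prod_coe_sort S]
    refine Fintype.prod_equiv e _ _ fun ρ => ?_
    have h1 := hb1 (e ρ)
    simp only [Equiv.symm_apply_apply] at h1 ⊢
    rw [← liouvilleInt_natCast]
    congr 1
    push_cast
    rw [Int.toNat_of_nonneg (by omega)]
    ring

/-- **The reduction from explicit forms.** If `λ(P(n + N)) = ε ∏ᵢ λ(aᵢ n + bᵢ)` for all `n` (forms
`aᵢ n + bᵢ`, `bᵢ ≥ 1`, sign `ε = ±1`) and the correlation `∑_{n≤x} ∏ᵢ λ(aᵢn+bᵢ)` is at most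
`(1 − δ)x` in modulus for large `x`, then each sign `v` of `λ(P(n))` has lower density `≥ δ/4` on
`[1, x]`. (The body of `teravainen2024_cor_2_1_of_correlationBound`, parametrised by the forms.)
[cite: Teravainen2024, Corollary 2.1 and Theorem 2.6 (§2.1–2.2)] -/
theorem lowerDensity_of_forms_of_correlationBound {P : ℤ[X]} {k : ℕ} {a b : Fin k → ℕ} {ε : ℤ}
    {N : ℕ} (hb : ∀ i, 1 ≤ b i) (hε : ε = 1 ∨ ε = -1)
    (hid : ∀ n : ℕ, liouvilleInt (P.eval ((n : ℤ) + N))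
      = ε * ∏ i, (ArithmeticFunction.liouville (a i * n + b i) : ℤ))
    {δ : ℝ} (hδ : 0 < δ) {x₀ : ℕ}
    (hx₀ : ∀ x : ℕ, x₀ ≤ x →
      |∑ n ∈ Icc 1 x, ∏ i, (ArithmeticFunction.liouville (a i * n + b i) : ℝ)| ≤ (1 - δ) * x)
    (v : ℤ) (hv : v = 1 ∨ v = -1) :
    ∀ x : ℕ, max (x₀ + N) (2 * N) ≤ x →
      δ / 4 * (x : ℝ) ≤ (((Finset.Icc 1 x).filter
        (fun n : ℕ => liouvilleInt (P.eval (n : ℤ)) = v)).card : ℝ) := by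
  -- the shifted sign sequence
  set f : ℕ → ℤ := fun n => ε * ∏ i, (ArithmeticFunction.liouville (a i * n + b i) : ℤ) with hf
  have hprod : ∀ n : ℕ, (∏ i, (ArithmeticFunction.liouville (a i * n + b i) : ℤ)) = 1 ∨
      (∏ i, (ArithmeticFunction.liouville (a i * n + b i) : ℤ)) = -1 := by
    intro n
    have : IsUnit (∏ i, (ArithmeticFunction.liouville (a i * n + b i) : ℤ)) := by
      refine (prod_mem (S := IsUnit.submonoid ℤ) fun i _ => ?_)
      have hne : a i * n + b i ≠ 0 := by have := hb i; omega
      have := liouvilleInt_eq_one_or_eq_neg_one (m := ((a i * n + b i : ℕ) : ℤ)) (by exact_mod_cast hne)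
      rw [liouvilleInt_natCast] at this
      rcases this with h | h <;> simp [IsUnit.mem_submonoid_iff, h]
    exact Int.isUnit_iff.1 this
  have hf1 : ∀ n, 1 ≤ n → f n = 1 ∨ f n = -1 := by
    intro n _
    rcases hε with h | h <;> rcases hprod n with h' | h' <;> simp [hf, h, h']
  have hfsum : ∀ x : ℕ, x₀ ≤ x → |∑ n ∈ Icc 1 x, (f n : ℝ)| ≤ (1 - δ) * x := by
    intro x hx
    have h := hx₀ x hx
    have hεabs : |(ε : ℝ)| = 1 := by rcases hε with rfl | rfl <;> norm_num
    simp only [hf, Int.cast_mul, Int.cast_prod, ← mul_sum, abs_mul, hεabs, one_mul]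
    exact h
  have hdens : ∀ x : ℕ, x₀ ≤ x →
      δ * x / 2 ≤ ((Icc 1 x).filter (fun n => f n = v)).card := by
    intro x hx
    have h := hfsum x hx
    have hsplit := sum_filter_add_sum_filter_not (Icc 1 x) (fun n => f n = v) (fun n => (f n : ℝ))
    have hE : ∑ n ∈ (Icc 1 x).filter (fun n => f n = v), (f n : ℝ)
        = v * ((Icc 1 x).filter (fun n => f n = v)).card := by
      rw [card_eq_sum_ones, Nat.cast_sum, Nat.cast_one, mul_sum]
      exact sum_congr rfl fun n hn => by rw [(mem_filter.1 hn).2]; simp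
    have hE' : ∑ n ∈ (Icc 1 x).filter (fun n => ¬ f n = v), (f n : ℝ)
        = -v * ((Icc 1 x).filter (fun n => ¬ f n = v)).card := by
      rw [card_eq_sum_ones, Nat.cast_sum, Nat.cast_one, mul_sum]
      refine sum_congr rfl fun n hn => ?_
      have hn1 : 1 ≤ n := (mem_Icc.1 (mem_filter.1 hn).1).1
      rw [eq_neg_of_ne_of_sign (hf1 n hn1) hv (mem_filter.1 hn).2]
      simp
    have hcard : (((Icc 1 x).filter (fun n => f n = v)).card : ℝ)
        + ((Icc 1 x).filter (fun n => ¬ f n = v)).card = x := by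
      exact_mod_cast (card_filter_add_card_filter_not (s := Icc 1 x) (fun n => f n = v)).trans
        (by simp)
    rw [← hsplit, hE, hE'] at h
    have hvabs : |(v : ℝ)| = 1 := by rcases hv with rfl | rfl <;> norm_num
    have : |(v : ℝ) * (2 * ((Icc 1 x).filter (fun n => f n = v)).card - x)| ≤ (1 - δ) * x := by
      calc |(v : ℝ) * (2 * ((Icc 1 x).filter (fun n => f n = v)).card - x)|
          = |(v : ℝ) * ((Icc 1 x).filter (fun n => f n = v)).card
              + -v * ((Icc 1 x).filter (fun n => ¬ f n = v)).card| := by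
            congr 1; rw [← hcard]; ring
        _ ≤ (1 - δ) * x := h
    rw [abs_mul, hvabs, one_mul, abs_le] at this
    linarith [this.1]
  intro x hx
  have hxN : N ≤ x := by omega
  have hx1 : x₀ ≤ x - N := by omega
  have hx2 : (x : ℝ) ≤ 2 * ((x - N : ℕ) : ℝ) := by
    have : 2 * N ≤ x := le_of_max_le_right hx
    have h' : x ≤ 2 * (x - N) := by omega
    exact_mod_cast h'
  have hinj : ((Icc 1 (x - N)).filter (fun n => f n = v)).card
      ≤ ((Icc 1 x).filter (fun n : ℕ => liouvilleInt (P.eval (n : ℤ)) = v)).card := by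
    apply card_le_card_of_injOn (fun n => n + N)
    · intro n hn
      rw [coe_filter, Set.mem_setOf_eq, mem_Icc] at hn ⊢
      obtain ⟨⟨hn1, hn2⟩, hfn⟩ := hn
      refine ⟨⟨?_, ?_⟩, ?_⟩
      · show 1 ≤ n + N
        omega
      · show n + N ≤ x
        omega
      · show liouvilleInt (P.eval ((n + N : ℕ) : ℤ)) = v
        rw [show ((n + N : ℕ) : ℤ) = (n : ℤ) + N by push_cast; ring, hid n, ← hfn]
    · intro m _ n _ h
      simpa using h
  have hd := hdens (x - N) hx1
  calc δ / 4 * (x : ℝ) ≤ δ * ((x - N : ℕ) : ℝ) / 2 := by nlinarith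
    _ ≤ ((Icc 1 (x - N)).filter (fun n => f n = v)).card := hd
    _ ≤ _ := by exact_mod_cast hinj

/-- **Corollary 2.1 ⇐ Theorem 2.6 (`g_j = λ`), truncated by the number of odd-multiplicity roots.**
If the 99% bound of Theorem 2.6 holds for the Liouville function and all `1 ≤ k ≤ K` pairwise
non-proportional forms, then Corollary 2.1 holds for every non-square `P` splitting over `ℚ` with
at most `K` distinct rational roots of odd multiplicity (the even-multiplicity roots and the
constant only contribute a fixed sign). [cite: Teravainen2024, Corollary 2.1 and Theorem 2.6 (§2.1–2.2)] -/
theorem teravainen2024_cor_2_1_of_correlationBound_oddRoots (K : ℕ)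
    (H : ∀ (k : ℕ) (a b : Fin k → ℕ), 1 ≤ k → k ≤ K → (∀ i, 1 ≤ a i) → (∀ i, 1 ≤ b i) →
      (∀ i j, i ≠ j → a i * b j ≠ a j * b i) →
      ∃ δ : ℝ, 0 < δ ∧ ∃ x₀ : ℕ, ∀ x : ℕ, x₀ ≤ x →
        |∑ n ∈ Icc 1 x, ∏ i, (ArithmeticFunction.liouville (a i * n + b i) : ℝ)| ≤ (1 - δ) * x)
    (P : Polynomial ℤ)
    (hK : ((P.map (Int.castRingHom ℚ)).roots.toFinset.filter
            (fun ρ => Odd ((P.map (Int.castRingHom ℚ)).roots.count ρ))).card ≤ K)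
    (hns : IsNonSquarePoly P) (hsp : FactorsIntoLinearFactorsOverRat P)
    (v : ℤ) (hv : v = 1 ∨ v = -1) :
    ∃ c : ℝ, 0 < c ∧ ∃ x₀ : ℕ, ∀ x : ℕ, x₀ ≤ x →
      c * (x : ℝ) ≤ (((Finset.Icc 1 x).filter
        (fun n : ℕ => liouvilleInt (P.eval (n : ℤ)) = v)).card : ℝ) := by
  obtain ⟨k, a, b, ε, N, hk1, hkeq, ha, hb, hab, hε, hid⟩ :=
    exists_linearForms_card_eq_oddRoots hns hsp
  obtain ⟨δ, hδ, x₀, hx₀⟩ := H k a b hk1 (hkeq ▸ hK) ha hb hab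
  exact ⟨δ / 4, by positivity, max (x₀ + N) (2 * N),
    lowerDensity_of_forms_of_correlationBound hb hε hid hδ hx₀ v hv⟩

/-- **Teräväinen 2024, Corollary 2.1 for `P` with at most two rational roots of odd multiplicity —
PROVED unconditionally.** For every non-square `P ∈ ℤ[x]` splitting over `ℚ` whose number of
distinct rational roots of odd multiplicity is `≤ 2` (e.g. every such `P` of degree `≤ 2`, but
also `x³(x+1)⁵(x+2)²`, `7x(2x+1)^4`, …) and either sign `v ∈ {−1,+1}`, the number of `n ≤ x` with
`λ(P(n)) = v` is `≫_P x`. This is the exact reach of Tao's two-point logarithmic Elliott theorem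
(`liouville_correlationBound_of_le_two`) through the reduction; three or more odd-multiplicity
roots need Theorem 2.6 with `k ≥ 3` (not in the tree; the named fact `teravainen2024_cor_2_1`).
[cite: Teravainen2024, Corollary 2.1 (case of ≤ 2 odd-multiplicity roots)] -/
theorem teravainen2024_cor_2_1_of_oddRoots_le_two (P : Polynomial ℤ)
    (hK : ((P.map (Int.castRingHom ℚ)).roots.toFinset.filter
            (fun ρ => Odd ((P.map (Int.castRingHom ℚ)).roots.count ρ))).card ≤ 2)
    (hns : IsNonSquarePoly P) (hsp : FactorsIntoLinearFactorsOverRat P) (v : ℤ)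
    (hv : v = 1 ∨ v = -1) :
    ∃ c : ℝ, 0 < c ∧ ∃ x₀ : ℕ, ∀ x : ℕ, x₀ ≤ x →
      c * (x : ℝ) ≤ (((Finset.Icc 1 x).filter
        (fun n : ℕ => liouvilleInt (P.eval (n : ℤ)) = v)).card : ℝ) :=
  teravainen2024_cor_2_1_of_correlationBound_oddRoots 2
    (fun k a b hk hk2 ha hb hab => liouville_correlationBound_of_le_two k a b hk hk2 ha hb hab)
    P hK hns hsp v hv

end OddRoots

end Literature.NumberTheory.Sieve
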